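import Literature.Analysis.FluidPDE.HomSobolevFrequencySplitting
import Literature.Analysis.FluidPDE.HomSobolevRepresentedSymbols
import HarnessLib

/-!
# Calderón's splitting of `Ḣ^{1/2}` Navier–Stokes data: `u₀ = a₀ + v₀`, `a₀` smooth and small
in `Ḣ^{1/2}`, `v₀ ∈ L²`, both real and divergence free (Rusin–Šverák 2011, §4)

Analysis/FluidPDE support file, definitions-free. Rusin–Šverák, J. Funct. Anal. 260 (2011) =
arXiv:0911.0500, §4 p. 6: "In our setting with `u₀ ∈ Ḣ^{1/2}` one can use the following trick
by C. Calderón to construct the weak solutions in a simple way. We can write `u₀ = a₀ + v₀`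
with `a₀` smooth and small in `Ḣ^{1/2}`, and `v₀` in `L²`. (For example, `a₀` can be defined in
terms of the Fourier transform as `â₀(ξ) = û₀(ξ)φ(ξ)`, where `φ` is a suitable smooth function
equal to `1` in a small neighborhood of `0`.) Since `a₀` is small, the Cauchy problem has a
global solution `a` which is small in `L⁴_t Ḣ¹_x`. We now seek solutions `u` in the form
`u = a + v` [...]". This is the first step of their construction of the Leray solutions `NS(u₀)`
and of the sketch "the only reason for `T_max(u₀) < ∞` can be a finite time singularity"
(p. 6), i.e. of the printed proofs behind the tree's named facts
`rusin_sverak_singular_point_of_blowup` and `rusin_sverak_weak_limit_of_singular_points`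
(and, in `L³`, of Jia–Šverák 2013, Lemma 7 / Lemarié-Rieusset 2016, Prop. 15.1).

This file **proves** the splitting for the tree's data — real, weakly divergence-free fields
`u₀ : ℝ³ → ℝ³` represented by a class `g ∈ Ḣ^{1/2}(ℝ³; ℂ³)` (`HomSobolev.Represents`) — with
the sharp cutoff `φ = 1_{B(0,Λ)}` (the analytic splitting of a general represented field is
`HomSobolev.Represents.exists_frequency_split`, `HomSobolevFrequencySplitting.lean`; here the two
pieces are shown to be again Navier–Stokes data):

* `HomSobolev.Represents.conj_fourierInv_indicator_ball_apply` — the low-frequency part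
  `𝓕⁻¹(1_{B(0,Λ)} û₀)` is **real** (Hermitian symmetry of `û₀`,
  `Represents.toLp_neg_apply_eq_conj` of `HomSobolevRepresentedSymbols.lean`, and `B(0,Λ) = -B(0,Λ)`);
* `HomSobolev.Represents.isWeaklyDivFree_of_symbol` — **a represented field whose symbol is
  incompressible (`∑ⱼ ξⱼ ĝ(ξ)ⱼ = 0` a.e.) is weakly divergence free** (converse of
  `Represents.sum_coord_mul_toLp_apply_eq_zero`: `∫ ∂ⱼθ aⱼ = ∫ 𝓕⁻¹(∂ⱼΘ) ĝⱼ` and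
  `𝓕⁻¹(∂ⱼΘ) = -2πi ξⱼ 𝓕⁻¹Θ`, Mathlib `SchwartzMap.fourierInv_lineDerivOp_eq`); the truncated
  symbol `1_{B(0,Λ)} û₀` is incompressible with `û₀`, so `a₀` is divergence free, and so is
  `v₀ = u₀ - a₀`;
* `HomSobolev.Represents.exists_calderon_split_frequency` — **the splitting at frequency `Λ`**:
  `u₀ = a₀ + v₀`, `g = g_a + g_v`, `g_a` represents `a₀` and `g_v` represents `v₀`,
  `ĝ_a = 1_{B(0,Λ)} û₀` (a.e.), `‖g_a‖ = ‖1_{B(0,Λ)} û₀‖_{L²(‖ξ‖dξ)} ≤ ‖g‖`, `‖g_v‖ ≤ ‖g‖`, `a₀` real,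
  `C^∞`, continuous, bounded (`‖a₀‖_∞ ≤ Λ J₁^{1/2} ‖g‖`), in `L³`, weakly divergence free;
  `v₀` real, in `L² ∩ L³` with `‖v₀‖_{L²} ≤ Λ^{-1/2} ‖g‖`, weakly divergence free;
* `HomSobolev.Represents.exists_calderon_split` — **the statement as printed**: for every
  `ε > 0` such a splitting with `‖g_a‖ < ε` ("`a₀` smooth and small in `Ḣ^{1/2}`, and `v₀` in
  `L²`"), by the smallness `‖1_{B(0,Λ)} û₀‖ → 0` as `Λ → 0`
  (`HomSobolev.exists_eLpNorm_indicator_ball_toLp_lt`).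

## Mathlib / tree search

Mathlib: `Real.fourierInv_eq`, `Real.fourierIntegral_convergent_iff`, `Circle.smul_def`,
`Circle.starRingEnd_addChar`, `integral_conj`, `integral_neg_eq_self`,
`SchwartzMap.fourierInv_lineDerivOp_eq`, `SchwartzMap.lineDerivOp_apply_eq_fderiv`,
`SchwartzMap.smulLeftCLM_apply_apply`, `contDiff_euclidean`, `Complex.conj_eq_iff_re`. Tree:
`HomSobolev.Represents.exists_frequency_split`, `HomSobolev.exists_eLpNorm_indicator_ball_toLp_lt`
(`HomSobolevFrequencySplitting.lean`), `HomSobolev.Represents.toLp_neg_apply_eq_conj`,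
`.sum_coord_mul_toLp_apply_eq_zero`, `.integral_mul_toLp_apply_eq`
(`HomSobolevRepresentedSymbols.lean`), `HomSobolev.Represents.sub/ae_eq`,
`memLp_three_of_represents_complexify`, `eLpNorm_complexify_comp` (`HomSobolevRepresentedL3.lean`),
`integral_inner_gradient_eq_sum` (`HomSobolevWeakLimits.lean`), `continuous_reCoords`
(`FujitaKatoLocal.lean`), `integrable_inner_of_locallyIntegrable_of_hasCompactSupport`
(`WeakGradientIBP.lean`).

## References

* W. Rusin, V. Šverák, J. Funct. Anal. 260 (2011) = arXiv:0911.0500, §4 p. 6.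
* C. P. Calderón, Trans. AMS 318 (1990) 179–200.
* H. Jia, V. Šverák, SIAM J. Math. Anal. 45 (2013) = arXiv:1201.1592, Lemma 7, Remark 1.
* P. G. Lemarié-Rieusset, *The Navier–Stokes problem in the 21st century* (2016), Prop. 15.1.
* L. Grafakos, *Classical Fourier Analysis*, 3rd ed., Prop. 2.2.11.
-/

noncomputable section

open MeasureTheory Set Function Filter Topology FourierTransform Real SchwartzMap
open scoped ENNReal NNReal InnerProductSpace ComplexConjugate LineDeriv

namespace Literature.Analysis.FluidPDE

section Calderon
open Literature.Analysis.FunctionSpaces (HomSobolev)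
open Literature.Analysis.FunctionSpaces.HomSobolev

variable {u₀ : EuclideanSpace ℝ (Fin 3) → EuclideanSpace ℝ (Fin 3)}
  {g : HomSobolev (EuclideanSpace ℝ (Fin 3)) (EuclideanSpace ℂ (Fin 3)) (1 / 2 : ℝ)}

/-- **The low-frequency part of a real datum is real.** If `g ∈ Ḣ^{1/2}(ℝ³; ℂ³)` represents
the real field `u₀` (through `complexify`), then every coordinate of the inverse Fourier
integral `𝓕⁻¹(1_{B(0,Λ)} û₀)(x)` is invariant under complex conjugation, for every `x`:
`conj ∫ e^{2πi⟨v,x⟩} 1_B û₀(v)ⱼ dv = ∫ e^{-2πi⟨v,x⟩} 1_B û₀(-v)ⱼ dv` by the Hermitian symmetry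
`û₀(-v)ⱼ = conj û₀(v)ⱼ` a.e. (`Represents.toLp_neg_apply_eq_conj`) and the symmetry of the
ball, and the substitution `v ↦ -v` returns the original integral (Grafakos, Prop. 2.2.11;
Rusin–Šverák 2011, §4 p. 6: `a₀` is a real field). [cite: RusinSverak2011, §4 p. 6 (arXiv:0911.0500: â₀ = û₀ φ defines a real field a₀)] -/
theorem _root_.Literature.Analysis.FunctionSpaces.HomSobolev.Represents.conj_fourierInv_indicator_ball_apply
    (h : g.Represents (FunctionSpaces.EuclideanSpace.complexify ∘ u₀)) {Λ : ℝ} (hΛ : 0 < Λ)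
    (x : EuclideanSpace ℝ (Fin 3)) (j : Fin 3) :
    conj (𝓕⁻ ((Metric.ball (0 : EuclideanSpace ℝ (Fin 3)) Λ).indicator
        ((toLp (1 / 2 : ℝ) g : Lp (EuclideanSpace ℂ (Fin 3)) 2
          (FunctionSpaces.homSobolevMeasure (EuclideanSpace ℝ (Fin 3)) (1 / 2 : ℝ))) :
            EuclideanSpace ℝ (Fin 3) → EuclideanSpace ℂ (Fin 3))) x j) =
      𝓕⁻ ((Metric.ball (0 : EuclideanSpace ℝ (Fin 3)) Λ).indicator
        ((toLp (1 / 2 : ℝ) g : Lp (EuclideanSpace ℂ (Fin 3)) 2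
          (FunctionSpaces.homSobolevMeasure (EuclideanSpace ℝ (Fin 3)) (1 / 2 : ℝ))) :
            EuclideanSpace ℝ (Fin 3) → EuclideanSpace ℂ (Fin 3))) x j := by
  set G : EuclideanSpace ℝ (Fin 3) → EuclideanSpace ℂ (Fin 3) :=
    ((toLp (1 / 2 : ℝ) g : Lp (EuclideanSpace ℂ (Fin 3)) 2
          (FunctionSpaces.homSobolevMeasure (EuclideanSpace ℝ (Fin 3)) (1 / 2 : ℝ))) :
            EuclideanSpace ℝ (Fin 3) → EuclideanSpace ℂ (Fin 3)) with hG_def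
  set B : Set (EuclideanSpace ℝ (Fin 3)) := Metric.ball 0 Λ with hB
  set K : EuclideanSpace ℝ (Fin 3) → EuclideanSpace ℂ (Fin 3) := B.indicator G with hK
  have hKi : Integrable K volume := (integrable_indicator_ball_toLp g hΛ).1
  -- Hermitian symmetry of the truncated symbol
  have hsymm : ∀ᵐ v ∂(volume : Measure (EuclideanSpace ℝ (Fin 3))), conj (K v j) = K (-v) j := by
    filter_upwards [h.toLp_neg_apply_eq_conj] with v hv
    have hmem : (-v ∈ B) ↔ (v ∈ B) := by simp [hB]
    by_cases hvB : v ∈ B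
    · have h1 : K v = G v := Set.indicator_of_mem hvB G
      have h2 : K (-v) = G (-v) := Set.indicator_of_mem (hmem.2 hvB) G
      rw [h1, h2]
      exact (hv j).symm
    · have h1 : K v = 0 := Set.indicator_of_notMem hvB G
      have h2 : K (-v) = 0 := Set.indicator_of_notMem (fun hh => hvB (hmem.1 hh)) G
      rw [h1, h2]
      simp
  -- the coordinate of the inverse Fourier integral
  set Fx : EuclideanSpace ℝ (Fin 3) → ℂ := fun v => ((𝐞 ⟪v, x⟫_ℝ : Circle) : ℂ) * K v j with hFx
  have hIx' : Integrable (fun v => (𝐞 ⟪v, x⟫_ℝ : Circle) • K v) volume := by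
    have := (Real.fourierIntegral_convergent_iff (μ := volume) (f := K) (-x)).2 hKi
    simpa only [inner_neg_right, neg_neg] using this
  have hIx : Integrable (fun v => ((𝐞 ⟪v, x⟫_ℝ : Circle) : ℂ) • K v) volume := by
    simpa only [Circle.smul_def] using hIx'
  have hcoord : 𝓕⁻ K x j = ∫ v, Fx v := by
    rw [Real.fourierInv_eq]
    simp_rw [Circle.smul_def]
    have h1 := (EuclideanSpace.proj (𝕜 := ℂ) j).integral_comp_comm hIx
    simp only [PiLp.proj_apply, WithLp.ofLp_smul, Pi.smul_apply, smul_eq_mul] at h1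
    exact h1.symm
  rw [hcoord, ← integral_conj]
  have h2 : ∀ᵐ v ∂(volume : Measure (EuclideanSpace ℝ (Fin 3))),
      (starRingEnd ℂ) (Fx v) = Fx (-v) := by
    filter_upwards [hsymm] with v hv
    simp only [hFx, map_mul, Circle.starRingEnd_addChar, hv, inner_neg_left]
  rw [integral_congr_ae h2]
  exact integral_neg_eq_self Fx volume

/-- **A represented field with incompressible symbol is weakly divergence free** (converse of
`Represents.sum_coord_mul_toLp_apply_eq_zero`). If `g_a ∈ Ḣ^{1/2}(ℝ³; ℂ³)` represents the real
field `a` and `∑ⱼ ξⱼ ĝ_a(ξ)ⱼ = 0` for a.e. `ξ`, then `∫ ⟪a, ∇θ⟫ = 0` for every real test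
function `θ`: `∫ ⟪a, ∇θ⟫ = ∑ⱼ ∫ ∂ⱼθ aⱼ` (`integral_inner_gradient_eq_sum`),
`∫ ∂ⱼθ aⱼ = ∫ 𝓕⁻¹(∂ⱼΘ) (ĝ_a)ⱼ` for the complex Schwartz function `Θ = θ`
(`Represents.integral_mul_toLp_apply_eq` with `φ = 𝓕⁻¹∂ⱼΘ`), and
`𝓕⁻¹(∂ⱼΘ)(ξ) = -2πi ξⱼ 𝓕⁻¹Θ(ξ)` (Mathlib `SchwartzMap.fourierInv_lineDerivOp_eq`; Grafakos
Prop. 2.2.11 (9)), so the sum is `-2πi ∫ 𝓕⁻¹Θ(ξ) ∑ⱼ ξⱼ ĝ_a(ξ)ⱼ dξ = 0`. With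
`Represents.sum_coord_mul_toLp_apply_eq_zero`: a represented real field is weakly divergence
free iff its symbol is incompressible. [folklore] -/
theorem _root_.Literature.Analysis.FunctionSpaces.HomSobolev.Represents.isWeaklyDivFree_of_symbol
    {a : EuclideanSpace ℝ (Fin 3) → EuclideanSpace ℝ (Fin 3)}
    {ga : HomSobolev (EuclideanSpace ℝ (Fin 3)) (EuclideanSpace ℂ (Fin 3)) (1 / 2 : ℝ)}
    (hrep : ga.Represents (FunctionSpaces.EuclideanSpace.complexify ∘ a))
    (hsymb : ∀ᵐ ξ : EuclideanSpace ℝ (Fin 3) ∂volume,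
      ∑ j, ((ξ j : ℝ) : ℂ) * ((toLp (1 / 2 : ℝ) ga : Lp (EuclideanSpace ℂ (Fin 3)) 2
        (FunctionSpaces.homSobolevMeasure (EuclideanSpace ℝ (Fin 3)) (1 / 2 : ℝ))) :
          EuclideanSpace ℝ (Fin 3) → EuclideanSpace ℂ (Fin 3)) ξ j = 0) :
    IsWeaklyDivFree a := by
  classical
  set G : EuclideanSpace ℝ (Fin 3) → EuclideanSpace ℂ (Fin 3) :=
    ((toLp (1 / 2 : ℝ) ga : Lp (EuclideanSpace ℂ (Fin 3)) 2
        (FunctionSpaces.homSobolevMeasure (EuclideanSpace ℝ (Fin 3)) (1 / 2 : ℝ))) :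
          EuclideanSpace ℝ (Fin 3) → EuclideanSpace ℂ (Fin 3)) with hG_def
  intro θ hθ
  have haloc : LocallyIntegrable a volume :=
    (memLp_three_of_represents_complexify hrep).locallyIntegrable (by norm_num)
  rw [integral_inner_gradient_eq_sum haloc hθ.contDiff hθ.hasCompactSupport]
  -- the complex test function `Θ = θ` and its partial derivatives
  have hθd : Differentiable ℝ θ := hθ.contDiff.differentiable (by simp)
  have hθC : ContDiff ℝ ((⊤ : ℕ∞) : WithTop ℕ∞) (fun x => (θ x : ℂ)) :=
    Complex.ofRealCLM.contDiff.comp hθ.contDiff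
  have hθCc : HasCompactSupport (fun x => (θ x : ℂ)) := hθ.hasCompactSupport.comp_left Complex.ofReal_zero
  set Θ : 𝓢(EuclideanSpace ℝ (Fin 3), ℂ) := hθCc.toSchwartzMap hθC with hΘ
  have hΘ_apply : ∀ x, Θ x = (θ x : ℂ) := fun x => rfl
  set e : Fin 3 → EuclideanSpace ℝ (Fin 3) := fun j => EuclideanSpace.basisFun (Fin 3) ℝ j with he
  have hΨ : ∀ j x, (∂_{e j} Θ) x = ((fderiv ℝ θ x (e j) : ℝ) : ℂ) := by
    intro j x
    rw [lineDerivOp_apply_eq_fderiv]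
    show fderiv ℝ (fun y => ((θ y : ℝ) : ℂ)) x (e j) = _
    have hcomp : (fun y => ((θ y : ℝ) : ℂ)) = (Complex.ofRealCLM : ℝ → ℂ) ∘ θ := rfl
    rw [hcomp, (Complex.ofRealCLM.hasFDerivAt.comp x (hθd x).hasFDerivAt).fderiv]
    rfl
  -- the pairings `∫ ∂ⱼθ aⱼ` through `Represents` with `φⱼ = 𝓕⁻¹ ∂ⱼΘ`
  have hpair : ∀ j, ∫ ξ, (𝓕⁻ (∂_{e j} Θ) : 𝓢(EuclideanSpace ℝ (Fin 3), ℂ)) ξ * G ξ j =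
      ∫ x, ((fderiv ℝ θ x (e j) : ℝ) : ℂ) * ((a x j : ℝ) : ℂ) := by
    intro j
    rw [hG_def, hrep.integral_mul_toLp_apply_eq (𝓕⁻ (∂_{e j} Θ)) j]
    refine integral_congr_ae (Eventually.of_forall fun x => ?_)
    show 𝓕 (((𝓕⁻ (∂_{e j} Θ) : 𝓢(EuclideanSpace ℝ (Fin 3), ℂ))) : EuclideanSpace ℝ (Fin 3) → ℂ) x *
      ((a x j : ℝ) : ℂ) = _
    rw [← SchwartzMap.fourier_coe, fourier_fourierInv_eq, hΨ]
  -- the symbols `𝓕⁻¹ ∂ⱼΘ (ξ) = -2πi ξⱼ 𝓕⁻¹Θ (ξ)`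
  have hsymbside : ∀ j ξ, (𝓕⁻ (∂_{e j} Θ) : 𝓢(EuclideanSpace ℝ (Fin 3), ℂ)) ξ =
      -(2 * π * Complex.I) * (((ξ j : ℝ) : ℂ) * (𝓕⁻ Θ : 𝓢(EuclideanSpace ℝ (Fin 3), ℂ)) ξ) := by
    intro j ξ
    rw [fourierInv_lineDerivOp_eq Θ (e j)]
    have hg' : (fun ξ : EuclideanSpace ℝ (Fin 3) => inner ℝ ξ (e j)).HasTemperateGrowth := by fun_prop
    rw [smul_apply, smulLeftCLM_apply_apply hg', smul_eq_mul]
    congr 1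
    simp [he, EuclideanSpace.inner_single_right, Complex.real_smul]
  -- integrability of the symbol-side integrands
  have hintj : ∀ j, Integrable (fun ξ => (𝓕⁻ (∂_{e j} Θ) : 𝓢(EuclideanSpace ℝ (Fin 3), ℂ)) ξ * G ξ j)
      volume := fun j =>
    ((EuclideanSpace.proj (𝕜 := ℂ) j).integrable_comp (hrep.2.1 (𝓕⁻ (∂_{e j} Θ)))).congr
      (Eventually.of_forall fun ξ => rfl)
  have hintj' : ∀ j, Integrable (fun ξ => -(2 * π * Complex.I) *
      ((𝓕⁻ Θ : 𝓢(EuclideanSpace ℝ (Fin 3), ℂ)) ξ * (((ξ j : ℝ) : ℂ) * G ξ j))) volume := fun j => by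
    refine (hintj j).congr (Eventually.of_forall fun ξ => ?_)
    show (𝓕⁻ (∂_{e j} Θ) : 𝓢(EuclideanSpace ℝ (Fin 3), ℂ)) ξ * G ξ j = _
    rw [hsymbside]
    ring
  -- real integrals as complex integrals
  have hcast : ∀ j, ((∫ x, fderiv ℝ θ x (e j) * a x j : ℝ) : ℂ) =
      ∫ x, ((fderiv ℝ θ x (e j) : ℝ) : ℂ) * ((a x j : ℝ) : ℂ) := by
    intro j
    rw [← integral_complex_ofReal]
    refine integral_congr_ae (Eventually.of_forall fun x => ?_)
    push_cast
    ring
  suffices hC : (∑ j, ((∫ x, fderiv ℝ θ x (e j) * a x j : ℝ) : ℂ)) = 0 by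
    have : ((∑ j, ∫ x, fderiv ℝ θ x (e j) * a x j : ℝ) : ℂ) = 0 := by push_cast; exact hC
    exact_mod_cast this
  calc ∑ j, ((∫ x, fderiv ℝ θ x (e j) * a x j : ℝ) : ℂ)
      = ∑ j, ∫ ξ, (𝓕⁻ (∂_{e j} Θ) : 𝓢(EuclideanSpace ℝ (Fin 3), ℂ)) ξ * G ξ j :=
        Finset.sum_congr rfl fun j _ => by rw [hcast, ← hpair]
    _ = ∑ j, ∫ ξ, -(2 * π * Complex.I) *
          ((𝓕⁻ Θ : 𝓢(EuclideanSpace ℝ (Fin 3), ℂ)) ξ * (((ξ j : ℝ) : ℂ) * G ξ j)) :=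
        Finset.sum_congr rfl fun j _ => integral_congr_ae (Eventually.of_forall fun ξ => by
          show (𝓕⁻ (∂_{e j} Θ) : 𝓢(EuclideanSpace ℝ (Fin 3), ℂ)) ξ * G ξ j = _
          rw [hsymbside]; ring)
    _ = ∫ ξ, ∑ j, -(2 * π * Complex.I) *
          ((𝓕⁻ Θ : 𝓢(EuclideanSpace ℝ (Fin 3), ℂ)) ξ * (((ξ j : ℝ) : ℂ) * G ξ j)) :=
        (integral_finsetSum _ fun j _ => hintj' j).symm
    _ = ∫ ξ, -(2 * π * Complex.I) * ((𝓕⁻ Θ : 𝓢(EuclideanSpace ℝ (Fin 3), ℂ)) ξ *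
          ∑ j, ((ξ j : ℝ) : ℂ) * G ξ j) :=
        integral_congr_ae (Eventually.of_forall fun ξ => by
          simp only [Finset.mul_sum])
    _ = ∫ ξ, (0 : ℂ) := integral_congr_ae (hsymb.mono fun ξ hξ => by
          simp only [hξ, mul_zero])
    _ = 0 := by simp

/-- **Calderón's splitting of an `Ḣ^{1/2}` Navier–Stokes datum at frequency `Λ`** (Rusin–Šverák
2011, §4 p. 6, with the sharp cutoff `φ = 1_{B(0,Λ)}`). Let the real, weakly divergence-free
field `u₀ : ℝ³ → ℝ³` be represented by `g ∈ Ḣ^{1/2}(ℝ³; ℂ³)` and let `Λ > 0`. Then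
`u₀ = a₀ + v₀` and `g = g_a + g_v` where: `g_a` represents `a₀`, `g_v` represents `v₀`;
`ĝ_a = 1_{B(0,Λ)} û₀` a.e., `‖g_a‖ = ‖1_{B(0,Λ)} û₀‖_{L²(‖ξ‖dξ)}`, `‖g_a‖, ‖g_v‖ ≤ ‖g‖`; `a₀` and
`v₀` are weakly divergence free; `a₀` is `C^∞`, continuous, bounded by `Λ J₁^{1/2} ‖g‖`
(`J₁ = ∫_{B(0,1)} ‖ξ‖⁻¹ dξ`) and in `L³`; `v₀ ∈ L² ∩ L³` with `‖v₀‖_{L²} ≤ Λ^{-1/2} ‖g‖`.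
Construction: `a₀ = Re 𝓕⁻¹(1_{B(0,Λ)} û₀) = 𝓕⁻¹(1_{B(0,Λ)} û₀)`
(`Represents.conj_fourierInv_indicator_ball_apply`), `v₀ = u₀ - a₀`; the analytic facts are
`Represents.exists_frequency_split`; divergence-freeness of `a₀` is
`Represents.isWeaklyDivFree_of_symbol` (the truncated symbol is incompressible with `û₀`,
`Represents.sum_coord_mul_toLp_apply_eq_zero`), of `v₀` by difference.
[cite: RusinSverak2011, §4 p. 6 (arXiv:0911.0500: u₀ = a₀ + v₀, â₀ = û₀ φ, v₀ ∈ L²)] -/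
theorem _root_.Literature.Analysis.FunctionSpaces.HomSobolev.Represents.exists_calderon_split_frequency
    (h : g.Represents (FunctionSpaces.EuclideanSpace.complexify ∘ u₀)) (hdiv : IsWeaklyDivFree u₀)
    {Λ : ℝ} (hΛ : 0 < Λ) :
    ∃ (a₀ v₀ : EuclideanSpace ℝ (Fin 3) → EuclideanSpace ℝ (Fin 3))
      (ga gv : HomSobolev (EuclideanSpace ℝ (Fin 3)) (EuclideanSpace ℂ (Fin 3)) (1 / 2 : ℝ)),
      u₀ = a₀ + v₀ ∧ g = ga + gv ∧
      ga.Represents (FunctionSpaces.EuclideanSpace.complexify ∘ a₀) ∧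
      gv.Represents (FunctionSpaces.EuclideanSpace.complexify ∘ v₀) ∧
      ((toLp (1 / 2 : ℝ) ga : Lp (EuclideanSpace ℂ (Fin 3)) 2
          (FunctionSpaces.homSobolevMeasure (EuclideanSpace ℝ (Fin 3)) (1 / 2 : ℝ))) :
            EuclideanSpace ℝ (Fin 3) → EuclideanSpace ℂ (Fin 3)) =ᵐ[volume]
        (Metric.ball (0 : EuclideanSpace ℝ (Fin 3)) Λ).indicator ((toLp (1 / 2 : ℝ) g : Lp (EuclideanSpace ℂ (Fin 3)) 2
          (FunctionSpaces.homSobolevMeasure (EuclideanSpace ℝ (Fin 3)) (1 / 2 : ℝ))) :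
            EuclideanSpace ℝ (Fin 3) → EuclideanSpace ℂ (Fin 3)) ∧
      ‖ga‖ = (eLpNorm ((Metric.ball (0 : EuclideanSpace ℝ (Fin 3)) Λ).indicator ((toLp (1 / 2 : ℝ) g :
          Lp (EuclideanSpace ℂ (Fin 3)) 2 (FunctionSpaces.homSobolevMeasure (EuclideanSpace ℝ (Fin 3)) (1 / 2 : ℝ))) :
            EuclideanSpace ℝ (Fin 3) → EuclideanSpace ℂ (Fin 3))) 2
          (FunctionSpaces.homSobolevMeasure (EuclideanSpace ℝ (Fin 3)) (1 / 2 : ℝ))).toReal ∧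
      ‖ga‖ ≤ ‖g‖ ∧ ‖gv‖ ≤ ‖g‖ ∧
      IsWeaklyDivFree a₀ ∧ IsWeaklyDivFree v₀ ∧
      ContDiff ℝ ((⊤ : ℕ∞) : WithTop ℕ∞) a₀ ∧ Continuous a₀ ∧
      (∀ x, ‖a₀ x‖ₑ ≤ ENNReal.ofReal Λ *
        (∫⁻ ξ in Metric.ball (0 : EuclideanSpace ℝ (Fin 3)) 1, ‖ξ‖ₑ⁻¹) ^ (1 / 2 : ℝ) * ‖g‖ₑ) ∧
      MemLp a₀ 3 volume ∧ MemLp v₀ 2 volume ∧ MemLp v₀ 3 volume ∧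
      eLpNorm v₀ 2 volume ≤ ENNReal.ofReal Λ⁻¹ ^ (1 / 2 : ℝ) * ‖g‖ₑ := by
  obtain ⟨g₁, g₂, f₂, hsum, hc₁, -, hn₁, hle₁, hle₂, hrep₁, hrep₂, -, hcont, hsmooth, hbound, hf₂, hf₂n⟩ :=
    h.exists_frequency_split hΛ
  set G : EuclideanSpace ℝ (Fin 3) → EuclideanSpace ℂ (Fin 3) :=
    ((toLp (1 / 2 : ℝ) g : Lp (EuclideanSpace ℂ (Fin 3)) 2
        (FunctionSpaces.homSobolevMeasure (EuclideanSpace ℝ (Fin 3)) (1 / 2 : ℝ))) :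
          EuclideanSpace ℝ (Fin 3) → EuclideanSpace ℂ (Fin 3)) with hG_def
  set f₁ : EuclideanSpace ℝ (Fin 3) → EuclideanSpace ℂ (Fin 3) :=
    𝓕⁻ ((Metric.ball (0 : EuclideanSpace ℝ (Fin 3)) Λ).indicator G) with hf₁
  -- the real field `a₀ = Re f₁ = f₁`
  set a₀ : EuclideanSpace ℝ (Fin 3) → EuclideanSpace ℝ (Fin 3) :=
    fun x => WithLp.toLp 2 fun j => (f₁ x j).re with ha₀
  have hreal : ∀ x, FunctionSpaces.EuclideanSpace.complexify (a₀ x) = f₁ x := by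
    intro x
    ext j
    have hc := h.conj_fourierInv_indicator_ball_apply hΛ x j
    rw [FunctionSpaces.EuclideanSpace.complexify_apply]
    simp only [ha₀, PiLp.toLp_apply]
    exact Complex.conj_eq_iff_re.1 hc
  have hfa : (FunctionSpaces.EuclideanSpace.complexify ∘ a₀) = f₁ := funext hreal
  have hrep_a : g₁.Represents (FunctionSpaces.EuclideanSpace.complexify ∘ a₀) := by
    rw [hfa]
    exact hrep₁
  -- the finite-energy remainder `v₀ = u₀ - a₀`
  set v₀ : EuclideanSpace ℝ (Fin 3) → EuclideanSpace ℝ (Fin 3) := fun x => u₀ x - a₀ x with hv₀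
  have hsum_u : u₀ = a₀ + v₀ := by
    funext x
    simp [hv₀]
  have hcv : (FunctionSpaces.EuclideanSpace.complexify ∘ v₀) =
      (FunctionSpaces.EuclideanSpace.complexify ∘ u₀) - (FunctionSpaces.EuclideanSpace.complexify ∘ a₀) := by
    funext x
    simp [hv₀, map_sub]
  have hg₂eq : g₂ = g - g₁ := by
    rw [hsum]
    abel
  have hrep_v : g₂.Represents (FunctionSpaces.EuclideanSpace.complexify ∘ v₀) := by
    rw [hcv, hg₂eq]
    exact h.sub hrep_a
  have hae_v : (FunctionSpaces.EuclideanSpace.complexify ∘ v₀) =ᵐ[volume] f₂ := hrep_v.ae_eq hrep₂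
  have hv2c : MemLp (FunctionSpaces.EuclideanSpace.complexify ∘ v₀) 2 volume := hf₂.ae_eq hae_v.symm
  have hv2 : MemLp v₀ 2 volume := memLp_complexify_comp_iff.1 hv2c
  have hv2n : eLpNorm v₀ 2 volume ≤ ENNReal.ofReal Λ⁻¹ ^ (1 / 2 : ℝ) * ‖g‖ₑ := by
    rw [← eLpNorm_complexify_comp, eLpNorm_congr_ae hae_v]
    exact hf₂n
  have hu3 : MemLp u₀ 3 volume := memLp_three_of_represents_complexify h
  have ha3 : MemLp a₀ 3 volume := memLp_three_of_represents_complexify hrep_a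
  have hv3 : MemLp v₀ 3 volume := memLp_three_of_represents_complexify hrep_v
  -- regularity and size of `a₀`
  have ha_cont : Continuous a₀ := continuous_reCoords.comp hcont
  have ha_smooth : ContDiff ℝ ((⊤ : ℕ∞) : WithTop ℕ∞) a₀ := by
    rw [contDiff_euclidean]
    intro j
    have h1 : ContDiff ℝ ((⊤ : ℕ∞) : WithTop ℕ∞) (fun x => f₁ x j) :=
      ((EuclideanSpace.proj (𝕜 := ℂ) j).restrictScalars ℝ).contDiff.comp hsmooth
    have h2 : (fun x => a₀ x j) = fun x => (f₁ x j).re := by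
      funext x
      simp [ha₀]
    rw [h2]
    exact Complex.reCLM.contDiff.comp h1
  have ha_bound : ∀ x, ‖a₀ x‖ₑ ≤ ENNReal.ofReal Λ *
      (∫⁻ ξ in Metric.ball (0 : EuclideanSpace ℝ (Fin 3)) 1, ‖ξ‖ₑ⁻¹) ^ (1 / 2 : ℝ) * ‖g‖ₑ := fun x => by
    have h1 : ‖a₀ x‖ₑ = ‖f₁ x‖ₑ := by
      rw [← ofReal_norm, ← ofReal_norm, ← hreal x, FunctionSpaces.EuclideanSpace.norm_complexify]
    rw [h1]
    exact hbound x
  -- divergence-freeness: the truncated symbol is still incompressible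
  have hsymb₁ : ∀ᵐ ξ : EuclideanSpace ℝ (Fin 3) ∂volume,
      ∑ j, ((ξ j : ℝ) : ℂ) * ((toLp (1 / 2 : ℝ) g₁ : Lp (EuclideanSpace ℂ (Fin 3)) 2
        (FunctionSpaces.homSobolevMeasure (EuclideanSpace ℝ (Fin 3)) (1 / 2 : ℝ))) :
          EuclideanSpace ℝ (Fin 3) → EuclideanSpace ℂ (Fin 3)) ξ j = 0 := by
    filter_upwards [hc₁, h.sum_coord_mul_toLp_apply_eq_zero hdiv] with ξ h1 h2
    rw [h1]
    by_cases hξ : ξ ∈ Metric.ball (0 : EuclideanSpace ℝ (Fin 3)) Λ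
    · rw [Set.indicator_of_mem hξ]
      exact h2
    · rw [Set.indicator_of_notMem hξ]
      simp
  have ha_div : IsWeaklyDivFree a₀ := hrep_a.isWeaklyDivFree_of_symbol hsymb₁
  have hv_div : IsWeaklyDivFree v₀ := by
    intro θ hθ
    have hgc : Continuous (gradient θ) :=
      (InnerProductSpace.toDual ℝ (EuclideanSpace ℝ (Fin 3))).symm.continuous.comp
        (hθ.contDiff.continuous_fderiv (by simp))
    have hgs : HasCompactSupport (gradient θ) :=
      (hθ.hasCompactSupport.fderiv (𝕜 := ℝ)).comp_left
        (g := (InnerProductSpace.toDual ℝ (EuclideanSpace ℝ (Fin 3))).symm) (map_zero _)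
    have iu := integrable_inner_of_locallyIntegrable_of_hasCompactSupport
      (hu3.locallyIntegrable (by norm_num)) hgc hgs
    have ia := integrable_inner_of_locallyIntegrable_of_hasCompactSupport
      (ha_cont.locallyIntegrable (μ := volume)) hgc hgs
    simp only [hv₀, inner_sub_left]
    rw [integral_sub iu ia, hdiv θ hθ, ha_div θ hθ, sub_zero]
  exact ⟨a₀, v₀, g₁, g₂, hsum_u, hsum, hrep_a, hrep_v, hc₁, hn₁, hle₁, hle₂, ha_div, hv_div, ha_smooth,
    ha_cont, ha_bound, ha3, hv2, hv3, hv2n⟩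

/-- **Calderón's trick for `Ḣ^{1/2}` data, as printed** (Rusin–Šverák, J. Funct. Anal. 260
(2011) = arXiv:0911.0500, §4 p. 6: "we can write `u₀ = a₀ + v₀` with `a₀` smooth and small in
`Ḣ^{1/2}`, and `v₀` in `L²`"). Let the real, weakly divergence-free field `u₀ : ℝ³ → ℝ³` be
represented by `g ∈ Ḣ^{1/2}(ℝ³; ℂ³)`. For every `ε > 0` there are real fields `a₀`, `v₀` and
classes `g_a`, `g_v` with `u₀ = a₀ + v₀`, `g = g_a + g_v`, `g_a` representing `a₀` and `g_v`
representing `v₀`, `‖g_a‖_{Ḣ^{1/2}} < ε` ("small in `Ḣ^{1/2}`"), `‖g_a‖, ‖g_v‖ ≤ ‖g‖`, both pieces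
weakly divergence free, `a₀ ∈ C^∞ ∩ L^∞ ∩ L³` ("smooth"), `v₀ ∈ L² ∩ L³` ("in `L²`")
(`exists_calderon_split_frequency` at a frequency `Λ` with `‖1_{B(0,Λ)} û₀‖ < ε`,
`HomSobolev.exists_eLpNorm_indicator_ball_toLp_lt`).
[cite: RusinSverak2011, §4 p. 6 (arXiv:0911.0500: Calderón's trick, u₀ = a₀ + v₀)] -/
theorem _root_.Literature.Analysis.FunctionSpaces.HomSobolev.Represents.exists_calderon_split
    (h : g.Represents (FunctionSpaces.EuclideanSpace.complexify ∘ u₀)) (hdiv : IsWeaklyDivFree u₀)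
    {ε : ℝ} (hε : 0 < ε) :
    ∃ (a₀ v₀ : EuclideanSpace ℝ (Fin 3) → EuclideanSpace ℝ (Fin 3))
      (ga gv : HomSobolev (EuclideanSpace ℝ (Fin 3)) (EuclideanSpace ℂ (Fin 3)) (1 / 2 : ℝ)),
      u₀ = a₀ + v₀ ∧ g = ga + gv ∧
      ga.Represents (FunctionSpaces.EuclideanSpace.complexify ∘ a₀) ∧
      gv.Represents (FunctionSpaces.EuclideanSpace.complexify ∘ v₀) ∧
      ‖ga‖ < ε ∧ ‖ga‖ ≤ ‖g‖ ∧ ‖gv‖ ≤ ‖g‖ ∧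
      IsWeaklyDivFree a₀ ∧ IsWeaklyDivFree v₀ ∧
      ContDiff ℝ ((⊤ : ℕ∞) : WithTop ℕ∞) a₀ ∧ (∃ C : ℝ, ∀ x, ‖a₀ x‖ ≤ C) ∧
      MemLp a₀ 3 volume ∧ MemLp v₀ 2 volume ∧ MemLp v₀ 3 volume := by
  obtain ⟨Λ, hΛ, hsmall⟩ := exists_eLpNorm_indicator_ball_toLp_lt g hε
  obtain ⟨a₀, v₀, ga, gv, hsum_u, hsum, hra, hrv, -, hn, hle₁, hle₂, hda, hdv, hsm, -, hbd, ha3, hv2, hv3, -⟩ :=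
    h.exists_calderon_split_frequency hdiv hΛ
  refine ⟨a₀, v₀, ga, gv, hsum_u, hsum, hra, hrv, ?_, hle₁, hle₂, hda, hdv, hsm, ?_, ha3, hv2, hv3⟩
  · rw [hn]
    exact ENNReal.toReal_lt_of_lt_ofReal hsmall
  · have hJ : (∫⁻ ξ in Metric.ball (0 : EuclideanSpace ℝ (Fin 3)) 1, ‖ξ‖ₑ⁻¹) ^ (1 / 2 : ℝ) ≠ ⊤ :=
      ENNReal.rpow_ne_top_of_nonneg (by norm_num) FunctionSpaces.SobolevEmbeddingHalf.lintegral_unitBall_inv_enorm_ne_top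
    have htop : ENNReal.ofReal Λ *
        (∫⁻ ξ in Metric.ball (0 : EuclideanSpace ℝ (Fin 3)) 1, ‖ξ‖ₑ⁻¹) ^ (1 / 2 : ℝ) * ‖g‖ₑ ≠ ⊤ :=
      ENNReal.mul_ne_top (ENNReal.mul_ne_top ENNReal.ofReal_ne_top hJ) enorm_ne_top
    refine ⟨(ENNReal.ofReal Λ *
        (∫⁻ ξ in Metric.ball (0 : EuclideanSpace ℝ (Fin 3)) 1, ‖ξ‖ₑ⁻¹) ^ (1 / 2 : ℝ) * ‖g‖ₑ).toReal,
      fun x => ?_⟩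
    rw [← toReal_enorm]
    exact ENNReal.toReal_mono htop (hbd x)

end Calderon

end Literature.Analysis.FluidPDE
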